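import Summits.ABC.IUTFork.Repair.RHOffRemainderToleranceMechanism
import HarnessLib

/-!
# R-H PAIR-5 TESTER, part 2/3 (§4): the S-unit family `P_{a,c}` at a fixed prime `l` — the deep slot-constant prime `7` and the lower bound
# `datum_offRemainder_empty_ge` on `R_∅(T)`, linear in the height

PROXY-FILED by abc-iut-rh-typ-5 (gen 5) for abc-iut-rh-tst-5 (gen 4) (refuter seats cannot stage under `Repair/`), 2026-08-27. The gate's proof-file
lint (≤ 400 lines) forces the tester's single staged file `RHOffRemainderToleranceRefutation.lean` (sha16 6609a97ef1f7db89, 757 l) to be SPLIT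
VERBATIM into three files of one namespace `Summit.ABC.IUTFork.Repair.RH.OffRemainderTolerance`, no declaration changed:
`RHOffRemainderToleranceMechanism.lean` (§1–§3), `RHOffRemainderToleranceSUnit.lean` (§4), `RHOffRemainderToleranceRefutation.lean` (§5, the
refutation theorems of record). The text below is the tester's, unchanged.
See `RHOffRemainderToleranceMechanism.lean` (part 1/3) for the full statement of results, mechanism, classification and honest framing (abc-iut-rh-tst-5
gen 4, verbatim). HONEST FRAMING: «these typed hypotheses are unsatisfiable / this binder is false AS TYPED», nothing more; nothing here asserts that abc
is proved or refuted, or that [IUTchIII] Cor. 3.12 holds or fails at any datum; no side taken on any author; typed ≠ proved; instantiated ≠ endorsed.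
[cite: Mochizuki2012, IUTchIV Thm. 1.10 pp. 22–31, Step (v) pp. 27–28; Cor. 2.2 (ii)–(iii) pp. 41–48] [cite: Mochizuki2012, IUTchIII Cor. 3.12 p. 174]
[cite: DupuyHilado2025, §3.3, §3.6, §4.7, §4.12] [claim: Mochizuki2012, status: disputed] for every IUT quotation.
-/

noncomputable section

open Set Function NumberField IsDedekindDomain
open scoped Pointwise

namespace Summit.ABC.IUTFork.Repair.RH.OffRemainderTolerance

open Summit.ABC.IUTFork.Thm311 Summit.ABC.IUTFork.Thm311.Real Summit.ABC.IUTFork.Cor312 Summit.ABC.IUTFork.Cor312.Setting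
  Summit.ABC.IUTFork.Cor312Vol Summit.ABC.IUTFork.Cor312Prov Summit.ABC.IUTFork.Repair.RH.SigmaLicence
  Literature.IUT.LogThetaLattice Literature.IUT.LogVolume Literature.IUT.HodgeTheaters Literature.NumberTheory.NumberFields

/-! ## §4. The S-unit family `P_{a,c}` at a fixed prime `l`: the deep slot-constant prime `7` -/

section SUnit

open Summit.ABC.IUTFork.SUnitFamily Literature.NumberTheory.DiophantineGeometry.GenEll Summit.ABC.ABC.Theorems
  Summit.ABC.IUTFork.PointDict

variable {a c : ℕ}

/-- **The local height of `j(λ_{a,c})` at the places of `F_{a,c}` over `7` is `−2c·log 7`** (normalised: `ord_𝔮(j)·log N(𝔮)/n_𝔮`):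
`V(F_{a,c})_7 = {𝔮₁, 𝔮₂}`, `ord_{𝔮ᵢ} j(λ) = −2c`, `N(𝔮ᵢ) = 7`, `n_{𝔮ᵢ} = 1` (abc-iut-s2-p4 `ord_at_q1`/`ord_at_q2`, `placesOver_eq_pair`).
[cite: Mochizuki2012, IUTchIV Cor. 2.2 (ii) proof (P2) p. 45] [claim: Mochizuki2012, status: disputed] -/
theorem sUnit_height_at_seven (ha : 1 ≤ a) (hc : 1 ≤ c) (V : HeightOneSpectrum (𝓞 (F a c)))
    (h7 : ((7 : ℕ) : 𝓞 (F a c)) ∈ V.asIdeal) :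
    (ord (F a c) V (Cor22.jInv (lam a c)) : ℝ) * logNorm (F a c) V / (localDegree (F a c) V : ℝ) =
      -(2 * (c : ℝ)) * Real.log 7 := by
  classical
  haveI : Fact (Nat.Prime 7) := ⟨by norm_num⟩
  obtain ⟨𝔭₁, 𝔭₂, 𝔮₁, 𝔮₂, -, -, ⟨k1, k1', k17, ko1⟩, ⟨k2, -, k27, ko2⟩⟩ := exists_four_places ha hc
  have hV : V ∈ placesOver (F a c) 7 := Cor22.mem_placesOver_of_natCast_mem 7 V h7
  rw [placesOver_eq_pair (p := 7) k1 k2 k17 k27, Finset.mem_insert, Finset.mem_singleton] at hV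
  obtain ⟨⟨-, hN1⟩, ⟨-, hN2⟩⟩ := weight_pair_eq_half (p := 7) k1 k2 k17 k27
  obtain ⟨hn1, hn2⟩ := localDegree_pair_eq_one (p := 7) k1 k2 k17 k27
  rcases hV with rfl | rfl
  · rw [ord_at_q1 hc k17 k1' ko1, hN1, hn1]; push_cast; ring
  · rw [ord_at_q2 hc k27 k2 ko2, hN2, hn2]; push_cast; ring

/-- **At a genuine Θ-volume datum `T` of `(P_{a,c}, l)` (`l ≠ 7` prime), every place `x` of `F` over `7` is a (P5)-bad place with
`ord_x(j_{E_F})·log N(x)/n_x = −2c·log 7`**: `j_{E_F} = j(λ_{a,c})` in `F` (`T.j_eq`), the normalised local height is extension-invariant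
(s2-p5 `ord_mul_logNorm_div_localDegree_algebraMap`), `x ∤ 2l`, and `E_F` is semistable with `ord_x j < 0`, hence multiplicative at `x`
(`T.isP5Choice`). [cite: Mochizuki2012, IUTchIV Cor. 2.2 (ii) proof (P5) p. 46] [claim: Mochizuki2012, status: disputed] -/
theorem datum_place_over_seven (ha : 1 ≤ a) (hc : 1 ≤ c) {l : ℕ} (hl : l.Prime) (hl7 : l ≠ 7)
    (T : Cor22.ThetaVolumeDatumAt (Pt a c) l) :
    (letI := T.instFieldF; letI := T.instNumberFieldF; letI := T.instAlgebraF; letI := T.instFieldK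
     letI := T.instNumberFieldK; letI := T.instAlgebraK; letI := T.instFieldFbar; letI := T.instAlgebraFbar
     letI := T.instAlgebraKFbar; letI := T.instIsElliptic
     ∀ x : HeightOneSpectrum (𝓞 T.F), ((7 : ℕ) : 𝓞 T.F) ∈ x.asIdeal →
       FinitePlace.mk x ∈ T.D.VFbad ∧
         (ord T.F x T.E.j : ℝ) * logNorm T.F x / (localDegree T.F x : ℝ) = -(2 * (c : ℝ)) * Real.log 7) := by
  letI := T.instFieldF; letI := T.instNumberFieldF; letI := T.instAlgebraF; letI := T.instFieldK
  letI := T.instNumberFieldK; letI := T.instAlgebraK; letI := T.instFieldFbar; letI := T.instAlgebraFbar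
  letI := T.instAlgebraKFbar; letI := T.instIsElliptic
  intro x hx7
  haveI : Fact (Nat.Prime 7) := ⟨by norm_num⟩
  have hx7' : ((7 : ℕ) : 𝓞 (Pt a c).F) ∈ (finBelow (Pt a c).F T.F x).asIdeal :=
    (Cor22.natCast_mem_asIdeal_finBelow_iff x 7).mpr hx7
  have hVp : finBelow (Pt a c).F T.F x ∈ placesOver (Pt a c).F 7 := Cor22.mem_placesOver_of_natCast_mem 7 _ hx7'
  have hval : (ord T.F x T.E.j : ℝ) * logNorm T.F x / (localDegree T.F x : ℝ) = -(2 * (c : ℝ)) * Real.log 7 := by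
    rw [T.j_eq, ord_mul_logNorm_div_localDegree_algebraMap x (Cor22.jInv (Pt a c).x)]
    exact sUnit_height_at_seven ha hc (finBelow (Pt a c).F T.F x) hx7'
  have hordx : ord T.F x T.E.j < 0 := by
    by_contra hge
    have h0 : (0 : ℝ) ≤ (ord T.F x T.E.j : ℝ) * logNorm T.F x / (localDegree T.F x : ℝ) :=
      div_nonneg (mul_nonneg (by exact_mod_cast not_lt.mp hge) (logNorm_pos T.F x).le) (Nat.cast_nonneg _)
    rw [hval] at h0
    have h7 : (0 : ℝ) < Real.log 7 := Real.log_pos (by norm_num)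
    have hc' : (1 : ℝ) ≤ c := by exact_mod_cast hc
    nlinarith
  have hmult : T.E.HasMultiplicativeReductionAt x := by
    refine (T.D.isSemistable x).resolve_left fun hgood => ?_
    have hle : x.valuation T.F T.E.j ≤ 1 := valuation_j_le_one_of_hasGoodReduction_localMinimalModel x T.E hgood
    have h0 : 0 ≤ ord T.F x T.E.j := by
      unfold ord
      rw [neg_nonneg]
      by_cases hz : x.valuation T.F T.E.j = 0
      · simp [hz]
      · rw [← WithZero.log_one]
        exact (WithZero.log_le_log hz one_ne_zero).mpr hle
    omega
  have hx2l : ∀ q ∈ ({2, l} : Finset ℕ), ((q : ℕ) : 𝓞 T.F) ∉ x.asIdeal := by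
    intro q hq hmem
    have hmem' : ((q : ℕ) : 𝓞 (Pt a c).F) ∈ (finBelow (Pt a c).F T.F x).asIdeal :=
      (Cor22.natCast_mem_asIdeal_finBelow_iff x q).mpr hmem
    simp only [Finset.mem_insert, Finset.mem_singleton] at hq
    rcases hq with rfl | rfl
    · exact SplitDepth.natCast_not_mem_of_prime_ne ⟨_, hVp⟩ Nat.prime_two (by norm_num) hmem'
    · exact SplitDepth.natCast_not_mem_of_prime_ne ⟨_, hVp⟩ hl hl7 hmem'
  exact ⟨(T.isP5Choice (FinitePlace.mk x)).mpr (by rw [FinitePlace.maximalIdeal_mk]; exact ⟨hx2l, hmult⟩), hval⟩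

/-- **THE DATUM-LEVEL LOWER BOUND (every realising idele, every context).** At a genuine Θ-volume datum `T` of `(P_{a,c}, l)`, `l ≥ 11` prime:
`((l(l+1)/12 − 1)·(c/l)·log 7) − (2·((l+5)/4)·(log 7 + 2·log(368640·l⁴) + 3) + log 7) ≤ R_∅(settingPrVolSharp (pilotDataOfK T.D T.K) … t_q t)`.
The prime `7` is DEEP and SLOT-CONSTANT for the family: both places of `F_mod = F_{a,c}` over `7` are bad with the same slot value
`μ = (c/l)·log 7` (§4), so `Q_7 = μ`, `δ_7 ≤ 2·((l+5)/4)·(log 7 + 2 log[K:ℚ] + 3) + log 7` (§3; `|V(F_mod)_7| = d_mod = 2`,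
`[K:ℚ] ≤ 184320·2·l⁴` by abc-iut-L5's `finrank_rat_K_le`), `negLogThetaLoc(7) ≤ −(l(l+1)/12)·Q_7 + δ_7` (abc-iut-S8 `negLogThetaLoc_le`),
and §2 gives `R_∅ ≥ −μ − negLogThetaLoc(7)`. LINEAR IN `c` at fixed `l`. [cite: Mochizuki2012, IUTchIV Thm. 1.10 Step (v) p. 27–28]
[cite: DupuyHilado2025, §3.3, §3.6, §4.7, §4.12] [claim: Mochizuki2012, status: disputed] -/
theorem datum_offRemainder_empty_ge (ha : 1 ≤ a) (hc : 1 ≤ c) {l : ℕ} (hl : l.Prime) (h11 : 11 ≤ l)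
    (T : Cor22.ThetaVolumeDatumAt (Pt a c) l) :
    letI := T.instFieldF; letI := T.instNumberFieldF; letI := T.instAlgebraF; letI := T.instFieldK;
    letI := T.instNumberFieldK; letI := T.instAlgebraK; letI := T.instFieldFbar; letI := T.instAlgebraFbar;
    letI := T.instAlgebraKFbar; letI := T.instIsElliptic;
    ∀ (M : Type) [Field M] [NumberField M]
      (archPk : ∀ (j : (thetaIndex (pilotDataOfK T.D T.K)).Label) (vQ : (thetaIndex (pilotDataOfK T.D T.K)).VQ),
        Set ((logShellsDH (pilotDataOfK T.D T.K) (analyticLogv T.K)).Packet j vQ))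
      (archSub : ∀ (j : (thetaIndex (pilotDataOfK T.D T.K)).Label) (v : (thetaIndex (pilotDataOfK T.D T.K)).V),
        Set ((logShellsDH (pilotDataOfK T.D T.K) (analyticLogv T.K)).Packet j ((thetaIndex (pilotDataOfK T.D T.K)).over v)))
      (Ψ : ℤ → ∀ v : (thetaIndex (pilotDataOfK T.D T.K)).V, v ∈ (thetaIndex (pilotDataOfK T.D T.K)).Vbad →
        Set ((logShellsDH (pilotDataOfK T.D T.K) (analyticLogv T.K)).StarPacket v))
      (act : ℤ → ∀ v : (thetaIndex (pilotDataOfK T.D T.K)).V, v ∈ (thetaIndex (pilotDataOfK T.D T.K)).Vbad →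
        (logShellsDH (pilotDataOfK T.D T.K) (analyticLogv T.K)).StarPacket v →
          Module.End ℚ ((logShellsDH (pilotDataOfK T.D T.K) (analyticLogv T.K)).StarPacket v))
      (Mmod : ℤ → ∀ j : (thetaIndex (pilotDataOfK T.D T.K)).LabelStar,
        Set ((logShellsDH (pilotDataOfK T.D T.K) (analyticLogv T.K)).GlobalPacket j.1))
      (region : ℤ → ∀ j : (thetaIndex (pilotDataOfK T.D T.K)).LabelStar, FinDivisor M →
        ∀ vQ : (thetaIndex (pilotDataOfK T.D T.K)).VQ, Set ((logShellsDH (pilotDataOfK T.D T.K) (analyticLogv T.K)).Packet j.1 vQ))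
      (n : ℤ) {HT : Type} {LogLink : HT → HT → Type} {IsFull : ∀ {s t : HT}, LogLink s t → Prop}
      (lat : LGPGaussianLogThetaLattice LogLink IsFull)
      {Frd : Type} {IsoF : Frd → Frd → Type} {Ob : Frd → Type} {realify : Frd → Frd} {Strip : Type}
      {IsoS : Strip → Strip → Type}
      {Mv : ∀ v : (thetaIndex (pilotDataOfK T.D T.K)).V, v ∈ (thetaIndex (pilotDataOfK T.D T.K)).Vbad → Type}
      [∀ v h, Monoid (Mv v h)]
      (sig : GlobalLGPFrobenioidSignature (thetaIndex (pilotDataOfK T.D T.K)).lstar (thetaIndex (pilotDataOfK T.D T.K)).V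
        (· ∈ (thetaIndex (pilotDataOfK T.D T.K)).Vbad) Frd IsoF Ob realify Strip IsoS Mv)
      (split : SplittingMonoids Mv) {ObΔ : Type}
      {N : ∀ v : (thetaIndex (pilotDataOfK T.D T.K)).V, v ∈ (thetaIndex (pilotDataOfK T.D T.K)).Vbad → Type} [∀ v h, Monoid (N v h)]
      (qData : QPilotData ObΔ N)
      (tq : ∀ (pp : Nat.Primes) (x : (thetaIndex (pilotDataOfK T.D T.K)).Fibre (.inr pp)),
        haveI : Fact (pp : ℕ).Prime := ⟨pp.2⟩; kOf (pilotDataOfK T.D T.K) pp.1 x)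
      (t : ∀ (pp : Nat.Primes) (_ : Fin (pilotDataOfK T.D T.K).lstar) (x : (thetaIndex (pilotDataOfK T.D T.K)).Fibre (.inr pp)),
        haveI : Fact (pp : ℕ).Prime := ⟨pp.2⟩; kOf (pilotDataOfK T.D T.K) pp.1 x)
      (htq0 : ∀ pp x, tq pp x ≠ 0)
      (htq1 : ∀ (pp : Nat.Primes) (x : (thetaIndex (pilotDataOfK T.D T.K)).Fibre (.inr pp)),
        haveI : Fact (pp : ℕ).Prime := ⟨pp.2⟩; placeOf (pilotDataOfK T.D T.K) pp.1 x ∉ (pilotDataOfK T.D T.K).S → ‖tq pp x‖ = 1),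
      (∀ pp i x, t pp i x ≠ 0) →
      (∀ (pp : Nat.Primes) (i : Fin (pilotDataOfK T.D T.K).lstar) (x : (thetaIndex (pilotDataOfK T.D T.K)).Fibre (.inr pp)),
        haveI : Fact (pp : ℕ).Prime := ⟨pp.2⟩
        Real.log ‖t pp i x‖ = -((pilotDataOfK T.D T.K).thetaPilot i (placeOf (pilotDataOfK T.D T.K) pp.1 x)) *
          logNorm T.K (placeOf (pilotDataOfK T.D T.K) pp.1 x) / localDegree T.K (placeOf (pilotDataOfK T.D T.K) pp.1 x)) →
      (∀ (pp : Nat.Primes) (x : (thetaIndex (pilotDataOfK T.D T.K)).Fibre (.inr pp)),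
        haveI : Fact (pp : ℕ).Prime := ⟨pp.2⟩
        Real.log ‖tq pp x‖ = -((pilotDataOfK T.D T.K).qPilot (placeOf (pilotDataOfK T.D T.K) pp.1 x)) *
          logNorm T.K (placeOf (pilotDataOfK T.D T.K) pp.1 x) / localDegree T.K (placeOf (pilotDataOfK T.D T.K) pp.1 x)) →
      ((l : ℝ) * ((l : ℝ) + 1) / 12 - 1) * ((c : ℝ) / l * Real.log 7) -
          (2 * (((l : ℝ) + 5) / 4 * (Real.log 7 + 2 * Real.log (368640 * (l : ℝ) ^ 4) + 3)) + Real.log 7) ≤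
        offRemainder (settingPrVolSharp (pilotDataOfK T.D T.K) (logvAnalytic_analyticLogv (F := T.K)) M archPk archSub Ψ act Mmod
          region n lat sig split qData tq t htq0 htq1) ∅ := by
  intro M _ _ archPk archSub Ψ act Mmod region n HT LogLink IsFull lat Frd IsoF Ob realify Strip IsoS Mv _ sig split ObΔ N _ qData
    tq t htq0 htq1 ht0 ht htq
  letI := T.instFieldF; letI := T.instNumberFieldF; letI := T.instAlgebraF; letI := T.instFieldK
  letI := T.instNumberFieldK; letI := T.instAlgebraK; letI := T.instFieldFbar; letI := T.instAlgebraFbar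
  letI := T.instAlgebraKFbar; letI := T.instIsElliptic
  haveI h7i : Fact (Nat.Prime 7) := ⟨by norm_num⟩
  have hl7 : l ≠ 7 := by omega
  have hl0 : (l : ℝ) ≠ 0 := by exact_mod_cast hl.ne_zero
  have hlog7 : (0 : ℝ) < Real.log 7 := Real.log_pos (by norm_num)
  -- (i) every place of `F_mod = ℚ(j(E_F))` over `7` is bad, with slot value `μ = (c/l)·log 7`
  have hmod : ∀ v : HeightOneSpectrum (𝓞 ↥(fieldOfModuli T.E)), v ∈ placesOver ↥(fieldOfModuli T.E) 7 →
      v ∈ ThetaData.badPrimesMod T.D ∧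
        T.I.X.qPilot v * logNorm ↥(fieldOfModuli T.E) v / (localDegree ↥(fieldOfModuli T.E) v : ℝ) =
          (c : ℝ) / l * Real.log 7 := by
    intro v hv
    obtain ⟨x, hx⟩ := PlaceSection.exists_under_eq (F₀ := ↥(fieldOfModuli T.E)) (K := T.F) v
    have hxv : finBelow ↥(fieldOfModuli T.E) T.F x = v := HeightOneSpectrum.ext (by rw [← hx]; rfl)
    have hx7 : ((7 : ℕ) : 𝓞 T.F) ∈ x.asIdeal := by
      have h := natCast_residueChar_mem T.F x
      have hres : residueChar T.F x = 7 := by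
        rw [← residueChar_finBelow (F := ↥(fieldOfModuli T.E)), hxv]
        exact (mem_placesOver_iff_residueChar v).mp hv
      rwa [hres] at h
    obtain ⟨hVF, hvalx⟩ := datum_place_over_seven ha hc hl hl7 T x hx7
    have hbad : v ∈ ThetaData.badPrimesMod T.D := by
      have h1 := (ThetaData.mk_mem_VFbad_iff T.D x).mp hVF
      have he : HeightOneSpectrum.under (𝓞 ↥(fieldOfModuli T.E)) x = v := by
        rw [← hxv]; exact HeightOneSpectrum.ext rfl
      rwa [he] at h1
    refine ⟨hbad, ?_⟩
    have hμv := mu_eq T v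
    rw [if_pos hbad] at hμv
    rw [hμv]
    have key : (ord ↥(fieldOfModuli T.E) v (ThetaData.jMod T.E) : ℝ) * logNorm ↥(fieldOfModuli T.E) v /
        (localDegree ↥(fieldOfModuli T.E) v : ℝ) = -(2 * (c : ℝ)) * Real.log 7 := by
      rw [← hxv, ← ord_mul_logNorm_div_localDegree_algebraMap x (ThetaData.jMod T.E)]
      exact hvalx
    have e : ∀ q L m : ℝ, -q / (2 * (l : ℝ)) * L / m = -(1 / (2 * (l : ℝ))) * (q * L / m) := fun _ _ _ => by ring
    push_cast
    rw [e, key]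
    field_simp
  -- (ii) `7 ∈ T(I)`
  have h7T : (7 : ℕ) ∈ T.I.supportPrimes := by
    obtain ⟨v, hv⟩ := placesOver_nonempty ↥(fieldOfModuli T.E) 7
    have h := residueChar_mem_supportPrimes_of_bad T v (hmod v hv).1
    rwa [(mem_placesOver_iff_residueChar v).mp hv] at h
  -- (iii) slot constancy at `7`: `θ_{i+1}(v)·log N(v)/n_v = (i+1)²·μ`
  have hconst : ∀ i : Fin T.I.X.lstar, ∃ c' : ℝ, ∀ v : placesOver ↥(fieldOfModuli T.E) 7,
      T.I.X.thetaPilot i v.1 * logNorm ↥(fieldOfModuli T.E) v.1 / localDegree ↥(fieldOfModuli T.E) v.1 = c' := by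
    intro i
    refine ⟨((((i : ℕ) : ℝ) + 1) ^ 2) * ((c : ℝ) / l * Real.log 7), fun v => ?_⟩
    rw [PilotData.thetaPilot_eq_smul, Finsupp.smul_apply, smul_eq_mul, mul_assoc, mul_div_assoc, (hmod v.1 v.2).2]
  -- (iv) `Q_7 = μ`
  have hQ : FinDivisor.ndeg ↥(fieldOfModuli T.E)
      (∑ v : placesOver ↥(fieldOfModuli T.E) 7, FinDivisor.of v.1 (T.I.X.qPilot v.1)) = (c : ℝ) / l * Real.log 7 := by
    rw [map_sum]
    have hterm : ∀ v : placesOver ↥(fieldOfModuli T.E) 7,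
        FinDivisor.ndeg ↥(fieldOfModuli T.E) (FinDivisor.of v.1 (T.I.X.qPilot v.1)) =
          ((c : ℝ) / l * Real.log 7) * weight ↥(fieldOfModuli T.E) v.1 := by
      intro v
      rw [FinDivisor.ndeg_of, ← (hmod v.1 v.2).2]
      unfold weight
      have hn : (localDegree ↥(fieldOfModuli T.E) v.1 : ℝ) ≠ 0 := by
        exact_mod_cast (localDegree_pos ↥(fieldOfModuli T.E) v.1).ne'
      field_simp
    rw [Finset.sum_congr rfl fun v _ => hterm v, ← Finset.mul_sum, PilotData.sum_weight_placesOver, mul_one]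
  -- (v) the q-pilot of `K` is pure of slope `μ` at `7`
  have hslope : ∀ w ∈ placesOver T.K 7,
      (pilotDataOfK T.D T.K).qPilot w * logNorm T.K w = ((c : ℝ) / l * Real.log 7) * localDegree T.K w := by
    intro w hw
    have hx7 : ((7 : ℕ) : 𝓞 T.F) ∈ (finBelow T.F T.K w).asIdeal := by
      have h := natCast_residueChar_mem T.F (finBelow T.F T.K w)
      rwa [(mem_placesOver_iff_residueChar _).mp (finBelow_mem_placesOver T.F T.K hw)] at h
    obtain ⟨hVF, hvalx⟩ := datum_place_over_seven ha hc hl hl7 T (finBelow T.F T.K w) hx7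
    have hwS : w ∈ (pilotDataOfK T.D T.K).S := (mem_pilotDataOfK_S_iff T.D T.K w).mpr hVF
    rw [(pilotDataOfK T.D T.K).qPilot_apply_of_mem hwS]
    have hordq : ((pilotDataOfK T.D T.K).ordq w : ℝ) = -(ord T.K w (algebraMap T.F T.K T.E.j) : ℝ) := by
      rw [show (pilotDataOfK T.D T.K).ordq w = -ord T.K w (algebraMap T.F T.K T.E.j) from rfl, Int.cast_neg]
    have htr := ord_mul_logNorm_div_localDegree_algebraMap (F₀ := T.F) w T.E.j
    rw [hvalx] at htr
    have hn : (localDegree T.K w : ℝ) ≠ 0 := by exact_mod_cast (localDegree_pos T.K w).ne'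
    have h1 := (div_eq_iff hn).mp htr
    rw [hordq, pilotDataOfK_l]
    rw [div_mul_eq_mul_div, neg_mul, h1]
    field_simp
  -- (vi) §2: `R_∅ ≥ −μ − negLogThetaLoc(7)`
  have hge := neg_slope_sub_negLogThetaLoc_le_offRemainder_empty T.D M archPk archSub Ψ act Mmod region n lat sig split qData tq t
    htq0 htq1 ht0 ht htq T.isVolumeInputOf ⟨7, by norm_num⟩ h7T ((c : ℝ) / l * Real.log 7) hslope
  change -((c : ℝ) / l * Real.log 7) - T.I.negLogThetaLoc 7 ≤ _ at hge
  -- (vii) abc-iut-S8's per-prime computable half + the slot-constant Step (v) bound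
  have hθle := DHData.negLogThetaLoc_le T.I (p := 7) (by norm_num)
  rw [hQ, avgSq_eq T] at hθle
  have hδ := explicitDeltaAt_le_card_mul_of_slotConstant T.I hconst
  have hcard : (Fintype.card (placesOver ↥(fieldOfModuli T.E) 7) : ℝ) ≤ 2 := by
    have h1 : (placesOver ↥(fieldOfModuli T.E) 7).card ≤ Module.finrank ℚ ↥(fieldOfModuli T.E) :=
      PilotData.card_placesOver_le_finrank (F := ↥(fieldOfModuli T.E)) 7
    have h2 : Module.finrank ℚ ↥(fieldOfModuli T.E) = 2 := by
      rw [T.finrank_rat_fieldOfModuli_eq_dmod]; exact dmod_P ha hc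
    rw [Fintype.card_coe]
    exact_mod_cast h1.trans h2.le
  have hlstar : ((T.I.X.lstar : ℝ) + 3) / 2 = ((l : ℝ) + 5) / 4 := by
    have h1 : (T.I.X.l : ℝ) = 2 * T.I.X.lstar + 1 := T.I.X.l_cast
    have h2 : T.I.X.l = l := (X_S_eq T).2.2
    rw [h2] at h1
    linarith
  have hN1 : (1 : ℝ) ≤ Module.finrank ℚ T.K := by exact_mod_cast Module.finrank_pos (R := ℚ) (M := T.K)
  have hN : (Module.finrank ℚ T.K : ℝ) ≤ 368640 * (l : ℝ) ^ 4 := by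
    have h := T.finrank_rat_K_le
    rw [show (Pt a c).degree = 2 from finrank_F a c] at h
    have : (Module.finrank ℚ T.K : ℝ) ≤ ((184320 * 2 * l ^ 4 : ℕ) : ℝ) := by exact_mod_cast h
    push_cast at this
    linarith
  have hlogN : Real.log (Module.finrank ℚ T.K) ≤ Real.log (368640 * (l : ℝ) ^ 4) := Real.log_le_log (by linarith) hN
  have hlogN0 : 0 ≤ Real.log (Module.finrank ℚ T.K) := Real.log_nonneg hN1
  have hl5 : (0 : ℝ) < ((l : ℝ) + 5) / 4 := by positivity
  have hδ' : DHData.explicitDeltaAt T.I 7 ≤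
      2 * (((l : ℝ) + 5) / 4 * (Real.log 7 + 2 * Real.log (368640 * (l : ℝ) ^ 4) + 3)) + Real.log 7 := by
    rw [hlstar] at hδ
    push_cast at hδ
    have hA : 0 ≤ ((l : ℝ) + 5) / 4 * (Real.log 7 + 2 * Real.log (Module.finrank ℚ T.K) + 3) := by positivity
    have hAB : ((l : ℝ) + 5) / 4 * (Real.log 7 + 2 * Real.log (Module.finrank ℚ T.K) + 3) ≤
        ((l : ℝ) + 5) / 4 * (Real.log 7 + 2 * Real.log (368640 * (l : ℝ) ^ 4) + 3) :=
      mul_le_mul_of_nonneg_left (by linarith) hl5.le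
    nlinarith
  have hμ0 : 0 ≤ (c : ℝ) / l * Real.log 7 := by positivity
  nlinarith

end SUnit

end Summit.ABC.IUTFork.Repair.RH.OffRemainderTolerance

end
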